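import Mathlib
import HarnessLib
import Literature.Probability.Distributions.GaussianMoments

/-!
# THE MEAN OF `n` SQUARED STANDARD NORMALS CONCENTRATES AT RATE `√(2/n)`:
# `∫ x⁴ dN(0,1) = 3`, `Var(x²) = 2`, `Var((Σ_{j<n} w_j²)/n) = 2/n`, `E|(Σ_j w_j²)/n − 1| ≤ √(2/n)`

HONEST FRAMING: exact (Metropolis-corrected) sampling algorithms for lattice gauge theory;
figures of merit are autocorrelation/cost numbers at stated couplings and volumes; no
continuum-physics claim.

Venture `LatticeQCDFlow` (cell pub-lqcd), topic `Scoring`; FANOUT row 4 (`s0-u1-b`, GEN-33).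
NEW WORK of the cell (classical), no definition, nothing cited as a fact.

WHY (row 4).  The fixed-batch-count / fixed-replica-count calibrations of the cell are the scale
mixtures `L_{n+1}(q) = E ψ_q(V_n)` with `V_n = (Σ_{j<n} w_j²)/n` the mean of `n` i.i.d. squared
standard normals (`Scoring/GaussianStudentScaleMixture`).  Every quantitative statement about
their distance to the nominal `N(0,1)([−q, q]) = ψ_q(1)` (the "rate in `R`" listed NOT CLAIMED by
rows 4 and 13) needs ONE number: how far `V_n` is from `1` on average.  This Mathlib-only file types
it: the fourth moment of the standard normal is `3` (the tree's even-moment formula,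
`Literature/Probability/Distributions/GaussianMoments`), so `Var(Z²) = 2`, `Var(V_n) = 2/n`
(`variance_sum_pi`), and `E|V_n − 1| ≤ √(Var V_n) = √(2/n)` (the variance of `|V_n − 1|` is
non-negative); Mathlib-level statements.  The rate corollary `N(0,1)([−q,q]) − L_{n+1}(q) ≤ N(0,1)([−q,q])·√(2/n)` is
`Scoring/GaussianStudentCountRate`.

## Content

* `memLp_two_sq_gaussianReal`; **`variance_sq_gaussianReal`** — `Var(x²) = 2` under `N(0,1)` (the
  fourth moment `3` is the tree's `Literature.Probability.Distributions.integral_pow_even_gaussianReal_one`).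
* `pi_gaussianReal_integral_meanSq` — `∫ V_n = 1`; **`pi_gaussianReal_variance_meanSq`** —
  `Var(V_n) = 2/n` (`n ≥ 1`).
* **`pi_gaussianReal_integral_abs_meanSq_sub_one_le`** — `∫ |V_n − 1| dN(0,1)^{⊗n} ≤ √(2/n)`.

Mathlib only (`iteratedDeriv_mgf_zero`, `mgf_fun_id_gaussianReal`, `variance_sum_pi`,
`variance_eq_sub`, `variance_nonneg`).  [ours] throughout.
-/

open MeasureTheory ProbabilityTheory Filter Topology Finset

namespace Summit.Ventures.LatticeQCDFlow.Scoring

section FourthMoment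

/-- `x ↦ x²` is square integrable against `N(0,1)`. [ours] -/
theorem memLp_two_sq_gaussianReal : MemLp (fun x : ℝ => x ^ 2) 2 (gaussianReal 0 1) := by
  rw [memLp_two_iff_integrable_sq (by fun_prop)]
  refine (Literature.Probability.Distributions.integrable_pow_gaussianReal 0 1 4).congr
    (ae_of_all _ fun x => ?_)
  ring

/-- **`Var(Z²) = 2`** for `Z ~ N(0,1)`. [ours] -/
theorem variance_sq_gaussianReal : Var[fun x : ℝ => x ^ 2; gaussianReal 0 1] = 2 := by
  rw [variance_eq_sub memLp_two_sq_gaussianReal]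
  have h4 : ∫ x, ((fun x : ℝ => x ^ 2) ^ 2) x ∂(gaussianReal 0 1) = 3 := by
    -- the fourth moment `∫ x⁴ dN(0,1) = 3‼ = 3`, from the tree's even-moment formula
    have h := Literature.Probability.Distributions.integral_pow_even_gaussianReal_one 2
    norm_num [Nat.doubleFactorial] at h
    simp only [Pi.pow_apply, ← pow_mul]
    exact h
  have h2 : ∫ x, (fun x : ℝ => x ^ 2) x ∂(gaussianReal 0 1) = 1 := by
    have hv := variance_eq_sub (memLp_id_gaussianReal (μ := (0 : ℝ)) (v := 1) 2)
    rw [variance_id_gaussianReal] at hv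
    simp only [NNReal.coe_one, id_eq, Pi.pow_apply, integral_id_gaussianReal, ne_eq,
      OfNat.ofNat_ne_zero, not_false_eq_true, zero_pow, sub_zero] at hv
    simpa using hv.symm
  rw [h4, h2]
  norm_num

end FourthMoment

section MeanSquare

/-- `∫ (Σ_{j<n} w_j²)/n dN(0,1)^{⊗n} = 1` (`n ≥ 1`). [ours] -/
theorem pi_gaussianReal_integral_meanSq {n : ℕ} (hn : 1 ≤ n) :
    ∫ w, (∑ j, w j ^ 2) / (n : ℝ) ∂(Measure.pi fun _ : Fin n => gaussianReal 0 1) = 1 := by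
  set Q := Measure.pi fun _ : Fin n => gaussianReal 0 1 with hQ
  have hsq : ∀ j : Fin n, Integrable (fun w : Fin n → ℝ => w j ^ 2) Q ∧ ∫ w, w j ^ 2 ∂Q = 1 := by
    intro j
    have hev := measurePreserving_eval (fun _ : Fin n => gaussianReal 0 1) j
    have hint' : Integrable (fun x : ℝ => x ^ 2) (Q.map fun w : Fin n → ℝ => w j) := by
      rw [hev.map_eq]; exact (memLp_id_gaussianReal (μ := (0 : ℝ)) (v := 1) 2).integrable_sq
    refine ⟨hint'.comp_measurable (measurable_pi_apply j), ?_⟩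
    have h1 : ∫ w, w j ^ 2 ∂Q = ∫ x, x ^ 2 ∂(Q.map fun w : Fin n → ℝ => w j) :=
      (integral_map (φ := fun w : Fin n → ℝ => w j) (f := fun x : ℝ => x ^ 2)
        (measurable_pi_apply (X := fun _ : Fin n => ℝ) j).aemeasurable
        hint'.aestronglyMeasurable).symm
    rw [h1, hev.map_eq]
    have hv := variance_eq_sub (memLp_id_gaussianReal (μ := (0 : ℝ)) (v := 1) 2)
    rw [variance_id_gaussianReal] at hv
    simp only [NNReal.coe_one, id_eq, Pi.pow_apply, integral_id_gaussianReal, ne_eq,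
      OfNat.ofNat_ne_zero, not_false_eq_true, zero_pow, sub_zero] at hv
    simpa using hv.symm
  rw [integral_div, integral_finsetSum _ fun j _ => (hsq j).1]
  simp only [(hsq _).2, Finset.sum_const, Finset.card_univ, Fintype.card_fin, nsmul_eq_mul, mul_one]
  exact div_self (by exact_mod_cast (by omega : n ≠ 0))

/-- **`Var((Σ_{j<n} w_j²)/n) = 2/n`** under `N(0,1)^{⊗n}` (`n ≥ 1`). [ours] -/
theorem pi_gaussianReal_variance_meanSq {n : ℕ} (hn : 1 ≤ n) :
    Var[fun w : Fin n → ℝ => (∑ j, w j ^ 2) / (n : ℝ); Measure.pi fun _ : Fin n => gaussianReal 0 1]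
      = 2 / (n : ℝ) := by
  have hn0 : (n : ℝ) ≠ 0 := by exact_mod_cast (by omega : n ≠ 0)
  have hfun : (fun w : Fin n → ℝ => (∑ j, w j ^ 2) / (n : ℝ))
      = fun w => (n : ℝ)⁻¹ * (∑ j, fun w : Fin n → ℝ => (fun x : ℝ => x ^ 2) (w j)) w := by
    funext w
    simp only [Finset.sum_apply]
    rw [div_eq_inv_mul]
  rw [hfun, variance_const_mul, variance_sum_pi fun _ => memLp_two_sq_gaussianReal]
  simp only [variance_sq_gaussianReal, Finset.sum_const, Finset.card_univ, Fintype.card_fin,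
    nsmul_eq_mul]
  field_simp

/-- `E|Y| ≤ √(E Y²)`-type step: for a square-integrable `Y` with mean zero,
`∫ |Y| ≤ √(Var Y)` (the variance of `|Y|` is non-negative and `E|Y|² = E Y²`). [ours] -/
theorem integral_abs_le_sqrt_variance {Ω : Type*} [MeasurableSpace Ω] {P : Measure Ω}
    [IsProbabilityMeasure P] {Y : Ω → ℝ} (hY : MemLp Y 2 P) (h0 : ∫ ω, Y ω ∂P = 0) :
    ∫ ω, |Y ω| ∂P ≤ Real.sqrt (Var[Y; P]) := by
  have habs : MemLp (fun ω => |Y ω|) 2 P := hY.abs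
  have hv := variance_eq_sub habs
  have hnn := variance_nonneg (fun ω => |Y ω|) P
  have hsq : ∫ ω, ((fun ω => |Y ω|) ^ 2) ω ∂P = ∫ ω, (Y ^ 2) ω ∂P := by
    refine integral_congr_ae (ae_of_all _ fun ω => ?_)
    simp [sq_abs]
  have hVY : Var[Y; P] = ∫ ω, (Y ^ 2) ω ∂P := by
    rw [variance_eq_sub hY, h0]; ring
  rw [hsq, ← hVY] at hv
  have hle : (∫ ω, |Y ω| ∂P) ^ 2 ≤ Var[Y; P] := by linarith
  have hI0 : 0 ≤ ∫ ω, |Y ω| ∂P := integral_nonneg fun ω => abs_nonneg _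
  calc ∫ ω, |Y ω| ∂P = Real.sqrt ((∫ ω, |Y ω| ∂P) ^ 2) := by rw [Real.sqrt_sq hI0]
    _ ≤ Real.sqrt (Var[Y; P]) := Real.sqrt_le_sqrt hle

/-- **`E|(Σ_{j<n} w_j²)/n − 1| ≤ √(2/n)`** under `N(0,1)^{⊗n}` (`n ≥ 1`): the mean of `n` squared
standard normals is within `√(2/n)` of `1` in `L¹`. [ours] -/
theorem pi_gaussianReal_integral_abs_meanSq_sub_one_le {n : ℕ} (hn : 1 ≤ n) :
    ∫ w, |(∑ j, w j ^ 2) / (n : ℝ) - 1| ∂(Measure.pi fun _ : Fin n => gaussianReal 0 1)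
      ≤ Real.sqrt (2 / (n : ℝ)) := by
  set Q := Measure.pi fun _ : Fin n => gaussianReal 0 1 with hQ
  have hmem : MemLp (fun w : Fin n → ℝ => (∑ j, w j ^ 2) / (n : ℝ)) 2 Q := by
    have : MemLp (fun w : Fin n → ℝ => ∑ j, w j ^ 2) 2 Q :=
      memLp_finsetSum _ fun j _ =>
        (memLp_two_sq_gaussianReal).comp_measurePreserving (measurePreserving_eval _ j)
    exact (this.const_mul (n : ℝ)⁻¹).ae_eq (ae_of_all _ fun w => by
      show (n : ℝ)⁻¹ * ∑ j, w j ^ 2 = (∑ j, w j ^ 2) / (n : ℝ)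
      rw [div_eq_inv_mul])
  have hmem1 : MemLp (fun w : Fin n → ℝ => (∑ j, w j ^ 2) / (n : ℝ) - 1) 2 Q :=
    hmem.sub (memLp_const 1)
  have h0 : ∫ w, ((∑ j, w j ^ 2) / (n : ℝ) - 1) ∂Q = 0 := by
    rw [integral_sub (hmem.integrable (by norm_num)) (integrable_const _), pi_gaussianReal_integral_meanSq hn]
    simp
  have h := integral_abs_le_sqrt_variance hmem1 h0
  have hvar : Var[fun w : Fin n → ℝ => (∑ j, w j ^ 2) / (n : ℝ) - 1; Q] = 2 / (n : ℝ) := by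
    rw [show (fun w : Fin n → ℝ => (∑ j, w j ^ 2) / (n : ℝ) - 1)
        = fun w => (fun w : Fin n → ℝ => (∑ j, w j ^ 2) / (n : ℝ)) w - 1 from rfl,
      variance_sub_const hmem.aestronglyMeasurable, pi_gaussianReal_variance_meanSq hn]
  rwa [hvar] at h

end MeanSquare

end Summit.Ventures.LatticeQCDFlow.Scoring
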